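import Summits.CriticalPhenomena.CardyFormulaZ2.Theorems.CardyUSTContinuationKirchhoffExtremalLengthG02Holo1

/-!
# The conjugate in the bulk, II: local boundedness and reachability of the bulk faces
# ([GP19] §4.1 for the `meshDomain` / `discreteArc` discretisation)

Support file for `KirchhoffExtremalLength` (route CardyUSTContinuation of `CardyFormulaZ2`, item
stmt-CriticalPhenomena-11234), towards the upper half of `G02ModulusConvergence` (`…Defs.lean`).
Transposition of §L3 and §Reach of the tree's `SquareTilingHoloLimit.lean` to
`Ω_δ = discreteDomainGraph Ω δ`: `facePot_base`, `exists_local_bound_facePot` (local boundedness of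
the conjugates by chaining the Lipschitz bound along a path from the base point),
`exists_forall_reachable_near` (the faces of a compact subset belong to the face component of the
base for small meshes).
-/

noncomputable section

namespace Summit.CriticalPhenomena.CardyFormulaZ2.Theorems

namespace KirchhoffSlope

open Set Metric Filter Topology SimpleGraph
open Literature.Probability Literature.Probability.LatticeModels Literature.Probability.Percolation
open Literature.Probability.LatticeModels.SquareTiling (stepFlux walkFlux closedSq floorSq mem_closedSq_floorSq
  meshPoint_mem_closedSq dist_le_of_mem_closedSq dist_meshPoint_floorBase_le exists_kingChain_of_path
  abs_sub_floorSq_le_of_mem_closedSq floorSq_mem_block exists_dualWalk_of_path walkFlux_nil floorSq_mk near_of_shadow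
  lineMap_props)
open Literature.Probability.RandomPlanarGeometry

variable {Ω : Set ℂ} {δ : ℝ}

open WeakBeurling

open Classical in
/-- The conjugate vanishes at its base square. [folklore] -/
theorem facePot_base (R : ConformalRectangle) (hδ : 0 < δ)
    {h : Site 2 → ℝ} {T B : Set (Site 2)} (hT : T ⊆ meshBoundary R.carrier δ) (hB : B ⊆ meshBoundary R.carrier δ)
    (hharm : ∀ x, x ∉ T → x ∉ B →
      ∑ y ∈ ((zdGraph 2).neighborFinset x).filter (fun y => (discreteDomainGraph R.carrier δ).Adj x y), (h y - h x) = 0)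
    {p₀ : Site 2} (hp₀ : IsInnerFace R.carrier δ p₀) : facePot R.carrier δ h p₀ p₀ = 0 := by
  rw [facePot_eq_walkFlux R hδ hT hB hharm hp₀ (Walk.nil : (faceGraph R.carrier δ).Walk p₀ p₀)]
  simp [walkFlux_nil]


open Classical in
/-- **Local boundedness of the conjugates.** For `Ω` containing the point `c⋆ = xs + ys i` and
`z ∈ Ω`, there are `s > 0`, `M` and `δ₀ > 0` such that for every mesh `δ < δ₀` and every
potential `h` (with values in `[0,1]`, harmonic off `T_n ∪ B_n`), the base square of `c⋆` is
inner and the conjugate based there is bounded by `M` at all squares with mesh point in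
`B(z, s)` — by chaining the local Lipschitz bound `exists_forall_abs_facePot_sub_le_mul_dist`
along a path from `c⋆` to `z`. [folklore] -/
theorem exists_local_bound_facePot (R : ConformalRectangle) {xs ys : ℝ} (hc : (⟨xs, ys⟩ : ℂ) ∈ R.carrier) {z : ℂ} (hz : z ∈ R.carrier) :
    ∃ s > 0, ∃ M : ℝ, ∃ δ₀ > 0, ∀ δ, 0 < δ → δ < δ₀ → ∀ h : Site 2 → ℝ, (∀ x, h x ∈ Icc (0 : ℝ) 1) →
      (∀ x, x ∉ discreteArc R.carrier δ (R.arc 0) → x ∉ discreteArc R.carrier δ (R.arc 2) →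
        ∑ y ∈ ((zdGraph 2).neighborFinset x).filter (fun y => (discreteDomainGraph R.carrier δ).Adj x y),
          (h y - h x) = 0) →
      IsInnerFace R.carrier δ ![⌊xs / δ⌋, ⌊ys / δ⌋] ∧
      ∀ x : Site 2, meshPoint δ x ∈ ball z s → |facePot R.carrier δ h ![⌊xs / δ⌋, ⌊ys / δ⌋] x| ≤ M := by
  have hΩo : IsOpen R.carrier := R.isOpen
  have hΩc : IsConnected R.carrier := R.isConnected
  have hne : R.carrierᶜ.Nonempty := ⟨R.boundary 0, fun h =>
    (R.disjoint_carrier_frontier.ne_of_mem h (R.boundary_mem_frontier 0)) rfl⟩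
  -- a path from `c⋆` to `z` in `Ω`, and a tube about it
  have hpc : IsPathConnected R.carrier := (hΩo.isConnected_iff_isPathConnected).1 hΩc
  obtain ⟨γ, hγ⟩ := (hpc.joinedIn _ hc _ hz)
  set Γ : ℝ → ℂ := fun t => γ.extend t with hΓ
  have hΓc : Continuous Γ := γ.continuous_extend
  have hΓmem : ∀ t ∈ Icc (0 : ℝ) 1, Γ t ∈ R.carrier := fun t ht => by
    show γ.extend t ∈ R.carrier
    rw [show (t : ℝ) = ((⟨t, ht⟩ : Icc (0 : ℝ) 1) : ℝ) from rfl, Path.extend_extends' γ ⟨t, ht⟩]; exact hγ _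
  have hKc : IsCompact (Γ '' Icc 0 1) := isCompact_Icc.image hΓc
  have hKΩ : Γ '' Icc 0 1 ⊆ R.carrier := by rintro _ ⟨t, ht, rfl⟩; exact hΓmem t ht
  obtain ⟨ρ, hρ, hρΩ⟩ := hKc.exists_cthickening_subset_open hΩo hKΩ
  have hballΩ : ∀ t ∈ Icc (0 : ℝ) 1, closedBall (Γ t) ρ ⊆ R.carrier := fun t ht w hw =>
    hρΩ (Metric.mem_cthickening_of_dist_le w (Γ t) ρ _ (mem_image_of_mem Γ ht) (mem_closedBall.1 hw))
  -- uniform continuity: a partition `tᵢ = i/N` with consecutive points within `ρ/128`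
  obtain ⟨τ, hτ, hτu⟩ := Metric.uniformContinuousOn_iff.1 (isCompact_Icc.uniformContinuousOn_of_continuous hΓc.continuousOn)
    (ρ / 128) (by positivity)
  obtain ⟨N, hN⟩ := exists_nat_gt (1 / τ)
  have hNpos : 0 < N := by
    have : (0 : ℝ) < N := lt_trans (by positivity) hN
    exact_mod_cast this
  have hNr : (0 : ℝ) < N := by exact_mod_cast hNpos
  set t : ℕ → ℝ := fun i => (i : ℝ) / N with ht
  have htmem : ∀ i ≤ N, t i ∈ Icc (0 : ℝ) 1 := fun i hi =>
    ⟨by positivity, by rw [ht]; exact div_le_one_of_le₀ (by exact_mod_cast hi) hNr.le⟩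
  have htclose : ∀ i < N, dist (Γ (t (i + 1))) (Γ (t i)) < ρ / 128 := by
    intro i hi
    refine hτu _ (htmem _ hi) _ (htmem _ hi.le) ?_
    rw [ht, Real.dist_eq]; push_cast
    rw [show ((i : ℝ) + 1) / N - i / N = 1 / N by field_simp; ring, abs_of_pos (by positivity)]
    rw [div_lt_iff₀ hNr]; rw [div_lt_iff₀ hτ] at hN; linarith
  -- the Lipschitz bounds on the balls `B(Γ tᵢ, ρ/32)`
  have hLip := fun i : Fin (N + 1) =>
    exists_forall_abs_facePot_sub_le_mul_dist R hρ (hballΩ (t i) (htmem i (Nat.lt_succ_iff.1 i.2)))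
  choose δL hδL hL using hLip
  -- the base square is inner for small meshes
  obtain ⟨δb, hδb, hinner⟩ := exists_forall_isInnerFace R.toJordanDomain hρ (hballΩ 0 ⟨le_rfl, zero_le_one⟩)
  set δ₀ : ℝ := min (min (Finset.univ.inf' Finset.univ_nonempty δL) δb) (ρ / 128) with hδ₀
  have hδ₀pos : 0 < δ₀ := by
    rw [hδ₀]; refine lt_min (lt_min ((Finset.lt_inf'_iff _).2 fun i _ => hδL i) hδb) (by positivity)
  have hK := topGradConst_pos
  set L : ℝ := 64 * topGradConst / ρ with hLdef
  have hL0 : 0 ≤ L := by positivity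
  refine ⟨ρ / 64, by positivity, L * ρ * (N + 2), δ₀, hδ₀pos, fun δ hδ hδlt h h01 hharm => ?_⟩
  have hδL' : ∀ i, δ < δL i := fun i =>
    hδlt.trans_le ((min_le_left _ _).trans ((min_le_left _ _).trans (Finset.inf'_le _ (Finset.mem_univ i))))
  have hδb' : δ < δb := hδlt.trans_le ((min_le_left _ _).trans (min_le_right _ _))
  have hδρ : δ < ρ / 128 := hδlt.trans_le (min_le_right _ _)
  have hΓ0 : Γ (t 0) = ⟨xs, ys⟩ := by simp [ht, hΓ]
  have hΓ1 : Γ (t N) = z := by rw [ht]; simp [hNr.ne', hΓ]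
  -- the base square
  set p₀ : Site 2 := ![⌊xs / δ⌋, ⌊ys / δ⌋] with hp₀
  have hp₀near : dist (meshPoint δ p₀) (Γ (t 0)) ≤ 2 * δ := by rw [hΓ0]; exact dist_meshPoint_floorBase_le hδ xs ys
  have hp₀inner : IsInnerFace R.carrier δ p₀ := by
    refine hinner δ hδ hδb' p₀ ?_
    rw [Metric.mem_ball]
    have : Γ 0 = Γ (t 0) := by simp [ht]
    rw [this]; linarith
  refine ⟨hp₀inner, fun x hx => ?_⟩
  -- the chain of lattice points
  set y : ℕ → Site 2 := fun i => nearestSite δ (Γ (t i)) with hy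
  have hynear : ∀ i, dist (meshPoint δ (y i)) (Γ (t i)) ≤ δ := fun i => dist_meshPoint_nearestSite_le hδ _
  have hTsub : discreteArc R.carrier δ (R.arc 0) ⊆ meshBoundary R.carrier δ := fun _ hx => hx.1
  have hBsub : discreteArc R.carrier δ (R.arc 2) ⊆ meshBoundary R.carrier δ := fun _ hx => hx.1
  -- Lipschitz on ball `i`
  have hLi : ∀ i ≤ N, ∀ a b : Site 2, meshPoint δ a ∈ ball (Γ (t i)) (ρ / 32) → meshPoint δ b ∈ ball (Γ (t i)) (ρ / 32) →
      |facePot R.carrier δ h p₀ a - facePot R.carrier δ h p₀ b| ≤ L * dist (meshPoint δ a) (meshPoint δ b) := by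
    intro i hi a b ha hb
    have := hL ⟨i, Nat.lt_succ_iff.2 hi⟩ δ hδ (hδL' _) h h01 hharm p₀ hp₀inner a b ha hb
    simpa [hLdef] using this
  -- step `i → i+1`
  have hstep : ∀ i < N, |facePot R.carrier δ h p₀ (y (i + 1)) - facePot R.carrier δ h p₀ (y i)| ≤ L * ρ := by
    intro i hi
    have ha : meshPoint δ (y (i + 1)) ∈ ball (Γ (t i)) (ρ / 32) := by
      rw [Metric.mem_ball]
      linarith [dist_triangle (meshPoint δ (y (i + 1))) (Γ (t (i + 1))) (Γ (t i)), hynear (i + 1), htclose i hi]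
    have hb : meshPoint δ (y i) ∈ ball (Γ (t i)) (ρ / 32) := by
      rw [Metric.mem_ball]; linarith [hynear i]
    refine (hLi i hi.le _ _ ha hb).trans (mul_le_mul_of_nonneg_left ?_ hL0)
    rw [Metric.mem_ball] at ha hb
    linarith [dist_triangle (meshPoint δ (y (i + 1))) (Γ (t i)) (meshPoint δ (y i)), dist_comm (Γ (t i)) (meshPoint δ (y i))]
  have hchain : ∀ i ≤ N, |facePot R.carrier δ h p₀ (y i) - facePot R.carrier δ h p₀ (y 0)| ≤ L * ρ * i := by
    intro i hi
    induction i with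
    | zero => simp
    | succ i ih =>
      have h1 := ih (Nat.le_of_succ_le hi)
      have h2 := hstep i hi
      have := abs_sub_le (facePot R.carrier δ h p₀ (y (i + 1))) (facePot R.carrier δ h p₀ (y i)) (facePot R.carrier δ h p₀ (y 0))
      push_cast
      linarith
  -- the ends
  have hstart : |facePot R.carrier δ h p₀ (y 0) - facePot R.carrier δ h p₀ p₀| ≤ L * ρ := by
    have ha : meshPoint δ (y 0) ∈ ball (Γ (t 0)) (ρ / 32) := by rw [Metric.mem_ball]; linarith [hynear 0]
    have hb : meshPoint δ p₀ ∈ ball (Γ (t 0)) (ρ / 32) := by rw [Metric.mem_ball]; linarith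
    refine (hLi 0 (Nat.zero_le _) _ _ ha hb).trans (mul_le_mul_of_nonneg_left ?_ hL0)
    rw [Metric.mem_ball] at ha hb
    linarith [dist_triangle (meshPoint δ (y 0)) (Γ (t 0)) (meshPoint δ p₀), dist_comm (Γ (t 0)) (meshPoint δ p₀)]
  have hend : |facePot R.carrier δ h p₀ x - facePot R.carrier δ h p₀ (y N)| ≤ L * ρ := by
    have hx' : meshPoint δ x ∈ ball (Γ (t N)) (ρ / 32) := by
      rw [hΓ1]; rw [Metric.mem_ball] at hx ⊢; linarith
    have hb : meshPoint δ (y N) ∈ ball (Γ (t N)) (ρ / 32) := by rw [Metric.mem_ball]; linarith [hynear N]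
    refine (hLi N le_rfl _ _ hx' hb).trans (mul_le_mul_of_nonneg_left ?_ hL0)
    rw [Metric.mem_ball] at hx' hb
    linarith [dist_triangle (meshPoint δ x) (Γ (t N)) (meshPoint δ (y N)), dist_comm (Γ (t N)) (meshPoint δ (y N))]
  have hbase : facePot R.carrier δ h p₀ p₀ = 0 := facePot_base R hδ hTsub hBsub hharm hp₀inner
  have h3 := hchain N le_rfl
  have h4 := abs_sub_le (facePot R.carrier δ h p₀ x) (facePot R.carrier δ h p₀ (y N)) (facePot R.carrier δ h p₀ (y 0))
  have h5 := abs_sub_le (facePot R.carrier δ h p₀ x) (facePot R.carrier δ h p₀ (y 0)) (facePot R.carrier δ h p₀ p₀)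
  simp only [hbase, sub_zero] at h5 hstart
  have hρL : 0 ≤ L * ρ := by positivity
  have e : L * ρ * ((N : ℝ) + 2) = L * ρ * N + L * ρ + L * ρ := by ring
  rw [e]
  linarith




/-- **Squares near a point of `Ω` are inner and in the component of the base square of `c⋆`,
for all small meshes.** [folklore] -/
theorem exists_forall_reachable_near (R : ConformalRectangle) {xs ys : ℝ} (hc : (⟨xs, ys⟩ : ℂ) ∈ R.carrier) {z : ℂ} (hz : z ∈ R.carrier) :
    ∃ s > 0, ∃ δ₀ > 0, ∀ δ, 0 < δ → δ < δ₀ →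
      IsInnerFace R.carrier δ ![⌊xs / δ⌋, ⌊ys / δ⌋] ∧
      ∀ x : Site 2, meshPoint δ x ∈ ball z s →
        IsInnerFace R.carrier δ x ∧ (faceGraph R.carrier δ).Reachable ![⌊xs / δ⌋, ⌊ys / δ⌋] x := by
  have hΩo : IsOpen R.carrier := R.isOpen
  have hΩc : IsConnected R.carrier := R.isConnected
  have hne : R.carrierᶜ.Nonempty := ⟨R.boundary 0, fun h =>
    (R.disjoint_carrier_frontier.ne_of_mem h (R.boundary_mem_frontier 0)) rfl⟩
  have hpc : IsPathConnected R.carrier := (hΩo.isConnected_iff_isPathConnected).1 hΩc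
  obtain ⟨γ, hγ⟩ := (hpc.joinedIn _ hc _ hz)
  set Γ : ℝ → ℂ := fun t => γ.extend t with hΓ
  have hΓc : Continuous Γ := γ.continuous_extend
  have hΓmem : ∀ t ∈ Icc (0 : ℝ) 1, Γ t ∈ R.carrier := fun t ht => by
    show γ.extend t ∈ R.carrier
    rw [show (t : ℝ) = ((⟨t, ht⟩ : Icc (0 : ℝ) 1) : ℝ) from rfl, Path.extend_extends' γ ⟨t, ht⟩]; exact hγ _
  set K := Γ '' Icc 0 1 with hK
  have hKc : IsCompact K := isCompact_Icc.image hΓc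
  have hKΩ : K ⊆ R.carrier := by rintro _ ⟨t, ht, rfl⟩; exact hΓmem t ht
  obtain ⟨ρ, hρ, hρΩ⟩ := hKc.exists_cthickening_subset_open hΩo hKΩ
  set K' := Metric.cthickening (ρ / 2) K with hK'
  have hK'c : IsCompact K' := hKc.cthickening
  have hK'Ω : K' ⊆ R.carrier := (Metric.cthickening_mono (by linarith) K).trans hρΩ
  obtain ⟨δ₁, hδ₁, hinn⟩ := exists_forall_isInnerFace_of_near R.toJordanDomain hK'c hK'Ω
  have hΓ0 : Γ 0 = ⟨xs, ys⟩ := by simp [hΓ]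
  have hΓ1 : Γ 1 = z := by simp [hΓ]
  have hzK : z ∈ K := ⟨1, ⟨zero_le_one, le_rfl⟩, hΓ1⟩
  refine ⟨ρ / 4, by positivity, min δ₁ (ρ / 16), by positivity, fun δ hδ hδlt => ?_⟩
  have hδ₁' : δ < δ₁ := hδlt.trans_le (min_le_left _ _)
  have hδρ : δ < ρ / 16 := hδlt.trans_le (min_le_right _ _)
  have hinn' : ∀ q : Site 2, (∃ w ∈ K', w ∈ closedSq δ q) → IsInnerFace R.carrier δ q := hinn δ hδ hδ₁'
  have hnearK : ∀ {w : ℂ}, (∃ y ∈ K, dist w y ≤ ρ / 2) → w ∈ K' := fun ⟨y, hy, hwy⟩ =>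
    Metric.mem_cthickening_of_dist_le _ y _ _ hy hwy
  -- the shadow of the path
  obtain ⟨ω₁, -, hω₁s⟩ := exists_dualWalk_of_path hδ zero_le_one hΓc.continuousOn
    (P := floorSq δ ⟨xs, ys⟩) (P' := floorSq δ z) (by rw [hΓ0]; exact mem_closedSq_floorSq hδ _) (by rw [hΓ1]; exact mem_closedSq_floorSq hδ _)
  have hp₀eq : (![⌊xs / δ⌋, ⌊ys / δ⌋] : Site 2) = floorSq δ ⟨xs, ys⟩ := (floorSq_mk δ xs ys).symm
  have hω₁inner : ∀ q ∈ ω₁.support, IsInnerFace R.carrier δ q := fun q hq => by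
    obtain ⟨w, hw, hwq⟩ := near_of_shadow hω₁s hq
    exact hinn' q ⟨w, hnearK ⟨w, hw, by rw [_root_.dist_self]; positivity⟩, hwq⟩
  refine ⟨by rw [hp₀eq]; exact hω₁inner _ (Walk.start_mem_support _), fun x hx => ?_⟩
  -- the shadow of the segment from `z` to the mesh point of `x`
  obtain ⟨hLc, hL0, hL1, hLim⟩ := lineMap_props z (meshPoint δ x)
  obtain ⟨ω₂, -, hω₂s⟩ := exists_dualWalk_of_path hδ zero_le_one hLc (P := floorSq δ z) (P' := x)
    (by show AffineMap.lineMap _ _ (0 : ℝ) ∈ _; rw [hL0]; exact mem_closedSq_floorSq hδ _)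
    (by show AffineMap.lineMap _ _ (1 : ℝ) ∈ _; rw [hL1]; exact meshPoint_mem_closedSq hδ.le (Or.inl rfl) (Or.inl rfl))
  have hω₂inner : ∀ q ∈ ω₂.support, IsInnerFace R.carrier δ q := fun q hq => by
    obtain ⟨w, hw, hwq⟩ := near_of_shadow hω₂s hq
    rw [hLim] at hw
    refine hinn' q ⟨w, hnearK ⟨z, hzK, ?_⟩, hwq⟩
    have h1 : dist w z ≤ dist (meshPoint δ x) z := by
      have := (convex_closedBall z (dist (meshPoint δ x) z)).segment_subset (mem_closedBall_self dist_nonneg)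
        (mem_closedBall.2 le_rfl) hw
      exact mem_closedBall.1 this
    rw [Metric.mem_ball] at hx
    linarith
  have hall : ∀ q ∈ (ω₁.append ω₂).support, IsInnerFace R.carrier δ q := fun q hq => by
    rw [Walk.mem_support_append_iff] at hq
    exact hq.elim (hω₁inner q) (hω₂inner q)
  refine ⟨hω₂inner x (Walk.end_mem_support _), ?_⟩
  rw [hp₀eq]
  exact reachable_of_mem_support_inner (ω₁.append ω₂) hall (Walk.start_mem_support _) (Walk.end_mem_support _)

open Classical in
/-- **Local equi-Lipschitz bound for G02 potentials** (`abs_sub_le_mul_dist_of_harmonicOnBoxes`,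
δ₀-form). [cite: GeorgakopoulosPanagiotis2019, §4.1] -/
theorem exists_forall_abs_sub_le_mul_dist' (R : ConformalRectangle) {z : ℂ} {r : ℝ} (hr : 0 < r) (hzr : closedBall z r ⊆ R.carrier) :
    ∃ δ₀ > 0, ∀ δ, 0 < δ → δ < δ₀ → ∀ h : Site 2 → ℝ, (∀ x, h x ∈ Icc (0 : ℝ) 1) →
      (∀ x, x ∉ discreteArc R.carrier δ (R.arc 0) → x ∉ discreteArc R.carrier δ (R.arc 2) →
        ∑ y ∈ ((zdGraph 2).neighborFinset x).filter (fun y => (discreteDomainGraph R.carrier δ).Adj x y),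
          (h y - h x) = 0) →
      ∀ x y : Site 2, meshPoint δ x ∈ ball z (r / 16) → meshPoint δ y ∈ ball z (r / 16) →
        |h x - h y| ≤ 64 * topGradConst / r * dist (meshPoint δ x) (meshPoint δ y) := by
  obtain ⟨δ₁, hδ₁, H⟩ := exists_forall_isLatticeHarmonicOn_boxInterior R.toJordanDomain (isCompact_closedBall z r) hzr
  refine ⟨min δ₁ (r / 72), by positivity, fun δ hδ hδlt h h01 hharm x y hx hy => ?_⟩
  exact abs_sub_le_mul_dist_of_harmonicOnBoxes hr hδ (hδlt.trans_le (min_le_right _ _)) h01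
    (H δ hδ (hδlt.trans_le (min_le_left _ _)) _ _ h hharm) x y hx hy

end KirchhoffSlope

end Summit.CriticalPhenomena.CardyFormulaZ2.Theorems
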